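import Literature.Computability.FineGrained.ForcedVariableRenaming
import Literature.Computability.FineGrained.SparsifierRoutines
import HarnessLib

/-!
# The renaming machine of Impagliazzo–Paturi's Lemma 2, II: forcing tables and their words

Family `fine-grained` (trunk T-CPLX-FINE). Second file of the machine half of
Impagliazzo–Paturi, *On the complexity of k-SAT*, JCSS 62 (2001), Lemma 2 (the named fact
`ipRename_reduceList_computable` of `IPLemma2Assembly.lean`, last open leaf under Theorem 3
`satExponent_le_satExponentLimit`; the forthcoming sibling `IPRenameTruthTable.lean` carries the
truth-table emission loop). The machine must compute `IPRename.reduceList` (`ForcedVariableRenaming.lean`)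
literally. This file is the *functional layer* between those list definitions and the machine's
registers: it says which tables the machine holds and proves that the notions of
`ForcedVariableRenaming.lean` are read off them.

* **Forcing tables.** For a variable `z`, `IPRename.entries P F z` lists, for the clauses
  containing `z` in order, the entry `(pt, pf, lits)`: the two *forcing patterns* (`patt`: every
  `z`-literal has the given polarity and every other variable is an `A`-variable, i.e.
  membership in `IPRename.forcingClauses`) and the renamed `A`-literals `aLits` (new indices
  `newIdxA`). Proved: `forcedTo_eq` / `forced_eq` (`IPRename.forcedTo`, `IPRename.forced` under
  `aOf w` are the table predicates `ftab`, `ffab`, `forcedT` evaluated at `w`), `depForced_eq`,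
  `depTheta_eq` (the dependency lists are the variables of the table literals, in order),
  `theta_eq`, `unforcedBefore_eq`, `psi_eq`, `yval_eq`, `block_blockOf_eq` (the block of
  `x ∈ B` splits at position `posIn x`) — exactly what a left-to-right pass over a block's
  tables with one lookup per literal computes.
* **Nonempty blocks.** `IPRename.numNB = ⌈|B|/m⌉`; blocks from `numNB` on are empty
  (`block_eq_nil_of_numNB_le`), earlier ones are not (`length_block_pos`),
  `numNB ≤ |B|/m + 1`. **`reduceList_eq_numNB`**: in `IPRename.reduceList` the `f`-vectors may
  be enumerated over the sizes of the nonempty blocks only — the padded components are `0`,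
  and padding an `f`-vector with zeros changes neither the threshold test nor `IPRename.reduce`
  (`reduce_padZ`, through `fAt_padZ`, …, `outClauses_padZ`). So the machine's mixed-radix
  counter has one digit per nonempty block.
* **Words over `Γ'`** (`blank | bit b | bra | ket | comma`) of the tables held in registers:
  index tokens `wIdx ν` (binary digits, comma); forcing-table entries `wEntry` (flag token
  `bit pt, bit pf, comma`, then the literals `cbody lits`, then `ket`), variables `wVar`
  (entries, `bra`), blocks `wBlock` (variables, `blank`), the block table `btab` / `wBT`;
  annotated literals `ALit` / `annLit` / `wALit` (polarity bit, tag bit, then the index token of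
  an `A`-literal or `i` kets and `j` bras and a comma for a `B`-literal in block `i` at position
  `j`), annotated clauses `wAClause` (closed by `blank`), `wAC`; the `Y`-table `ytab` / `wYBlock`
  / `wYT` (`f_i` blanks, comma, the index tokens of `Y_i`, `ket`). Every level of nesting has
  its own closing symbol, so that each table is parsed by a single pass with a constant-size
  mode.

## References

* R. Impagliazzo, R. Paturi, *On the complexity of k-SAT*, J. Comput. System Sci. 62 (2001)
  367–375, doi:10.1006/jcss.2000.1727: p. 371 (`(x, A)`-clauses, `G_x`, `G'_x`), p. 372
  (`Ψ`, `Θ_i`, `Φ_f`), Lemma 2 (p. 373) with its "Moreover" sentence (computing the reduction).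
  (Not held; acquisition request acq-00143.)
-/

namespace Literature.Computability.FineGrained.IPRename

variable (P : Params) (F : List (List (ℕ × Bool)))

/-! ### Forcing tables -/

/-- The forcing pattern of a clause `c` for the variable `z` and the polarity `p`: every
`z`-literal of `c` has polarity `p` and every other variable of `c` lies in `A` (so that
`c ∈ forcingClauses z p` iff `z` occurs in `c` and the pattern holds).
[cite: ImpagliazzoPaturiJCSS2001, p. 371 (the (x, A)-clauses)] -/
def patt (c : List (ℕ × Bool)) (z : ℕ) (p : Bool) : Bool :=
  c.all fun l => (l.1 == z && l.2 == p) || (l.1 != z && !inB P F l.1)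

/-- The `A`-literals of `c` on variables other than `z`, renamed to the new indices.
[folklore] -/
def aLits (c : List (ℕ × Bool)) (z : ℕ) : List (ℕ × Bool) :=
  (c.filter fun l => l.1 != z && !inB P F l.1).map fun l => (newIdxA P F l.1, l.2)

/-- An entry of the forcing table of a variable `z`: the two forcing patterns of a clause
containing `z` and its renamed `A`-literals. [folklore] -/
structure Entry where
  /-- the clause can force `z` to `true` -/
  pt : Bool
  /-- the clause can force `z` to `false` -/
  pf : Bool
  /-- the renamed `A`-literals of the clause other than `z` -/
  lits : List (ℕ × Bool)

/-- The entry of the clause `c` for `z`. [folklore] -/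
def entryOf (c : List (ℕ × Bool)) (z : ℕ) : Entry :=
  ⟨patt P F c z true, patt P F c z false, aLits P F c z⟩

/-- **The forcing table of `z`**: the entries of the clauses containing `z`, in order.
[folklore] -/
def entries (z : ℕ) : List Entry := (F.filter (occursIn z)).map fun c => entryOf P F c z

/-- All literals of an entry are false under the assignment `w` of the new variables.
[folklore] -/
def Entry.allFalse (e : Entry) (w : ℕ → Bool) : Bool := e.lits.all fun l => w l.1 != l.2

/-- `z` is forced to `true` according to its table. [folklore] -/
def ftab (z : ℕ) (w : ℕ → Bool) : Bool := (entries P F z).any fun e => e.pt && e.allFalse w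

/-- `z` is forced to `false` according to its table. [folklore] -/
def ffab (z : ℕ) (w : ℕ → Bool) : Bool := (entries P F z).any fun e => e.pf && e.allFalse w

/-- `z` is forced according to its table. [folklore] -/
def forcedT (z : ℕ) (w : ℕ → Bool) : Bool := ftab P F z w || ffab P F z w

/-- The forcing clauses are the clauses containing `z` with the forcing pattern. [folklore] -/
theorem forcingClauses_eq (z : ℕ) (p : Bool) :
    forcingClauses P F z p = F.filter fun c => occursIn z c && patt P F c z p := rfl

/-- Under the forcing pattern, "all other literals false under `aOf w`" is read off the entry.
[folklore] -/
theorem othersFalse_eq_allFalse {c : List (ℕ × Bool)} {z : ℕ} {p : Bool}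
    (hp : patt P F c z p = true) (w : ℕ → Bool) :
    othersFalse c z (aOf P F w) = (entryOf P F c z).allFalse w := by
  unfold othersFalse Entry.allFalse entryOf aLits aOf
  simp only [List.all_map]
  rw [List.all_filter]
  refine all_congr_mem c fun l hl => ?_
  unfold patt at hp
  have hl' := List.all_eq_true.1 hp l hl
  simp only [Bool.or_eq_true, Bool.and_eq_true, beq_iff_eq, bne_iff_ne, ne_eq,
    Bool.not_eq_true'] at hl'
  simp only [Function.comp_apply]
  by_cases hz : l.1 = z
  · simp [hz]
  · rcases hl' with ⟨h1, -⟩ | ⟨-, h2⟩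
    · exact absurd h1 hz
    · have e1 : (l.1 == z) = false := by simpa using hz
      have e2 : (l.1 != z) = true := by simpa [bne_iff_ne] using hz
      rw [e1, e2, h2]; simp

/-- **`forcedTo` read off the forcing table.** [folklore] -/
theorem forcedTo_eq (z : ℕ) (p : Bool) (w : ℕ → Bool) :
    forcedTo P F z p (aOf P F w) =
      (entries P F z).any fun e => (if p then e.pt else e.pf) && e.allFalse w := by
  unfold forcedTo entries
  rw [forcingClauses_eq, List.any_filter, List.any_map, List.any_filter]
  refine any_congr_mem F fun c _ => ?_
  simp only [Function.comp_apply]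
  cases hocc : occursIn z c
  · simp
  · simp only [Bool.true_and]
    have hpt : (if p then (entryOf P F c z).pt else (entryOf P F c z).pf) = patt P F c z p := by
      cases p <;> rfl
    rw [hpt]
    cases hp : patt P F c z p
    · simp
    · rw [othersFalse_eq_allFalse P F hp, Bool.true_and]

/-- `forcedTo … true` is `ftab`. [folklore] -/
theorem forcedTo_true_eq (z : ℕ) (w : ℕ → Bool) : forcedTo P F z true (aOf P F w) = ftab P F z w :=
  forcedTo_eq P F z true w

/-- `forcedTo … false` is `ffab`. [folklore] -/
theorem forcedTo_false_eq (z : ℕ) (w : ℕ → Bool) :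
    forcedTo P F z false (aOf P F w) = ffab P F z w :=
  forcedTo_eq P F z false w

/-- **`forced` read off the forcing table.** [folklore] -/
theorem forced_eq (z : ℕ) (w : ℕ → Bool) : forced P F z (aOf P F w) = forcedT P F z w := by
  rw [forced, forcedT, forcedTo_true_eq, forcedTo_false_eq]

/-- **`depForced` read off the forcing table**: the variables of its literals, in order.
[folklore] -/
theorem depForced_eq (z : ℕ) :
    depForced P F z = (entries P F z).flatMap fun e => e.lits.map Prod.fst := by
  unfold depForced entries entryOf aLits
  rw [List.flatMap_map]
  simp [List.map_map, Function.comp_def]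

/-- **`depTheta` read off the forcing tables of the block's variables.** [folklore] -/
theorem depTheta_eq (i : ℕ) :
    depTheta P F i = ((block P F i).map (entries P F)).flatMap
      fun es => es.flatMap fun e => e.lits.map Prod.fst := by
  unfold depTheta
  rw [List.flatMap_map]
  exact List.flatMap_congr fun z _ => depForced_eq P F z

/-- `theta` read off the forcing tables of the block. [folklore] -/
theorem theta_eq (i : ℕ) (w : ℕ → Bool) :
    theta P F i w = (((block P F i).countP fun z => forcedT P F z w) == fAt P F i) := by
  unfold theta
  rw [countP_congr_mem (block P F i) fun z _ => forced_eq P F z w]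

/-- `unforcedBefore` read off the forcing tables. [folklore] -/
theorem unforcedBefore_eq (x : ℕ) (w : ℕ → Bool) :
    unforcedBefore P F x (aOf P F w) =
      ((block P F (blockOf P F x)).take (posIn P F x)).countP fun z => !forcedT P F z w := by
  unfold unforcedBefore
  exact countP_congr_mem _ fun z _ => by rw [forced_eq]

/-- `psi` read off the forcing tables. [folklore] -/
theorem psi_eq (x : ℕ) (w : ℕ → Bool) :
    psi P F x w = (ftab P F x w || (!forcedT P F x w && yval P F x w)) := by
  rw [psi, forcedTo_true_eq, forced_eq]

/-- `yval` unfolded: the `r`-th renaming variable of the block, `r` the unforced rank.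
[folklore] -/
theorem yval_eq (x : ℕ) (w : ℕ → Bool) :
    yval P F x w =
      if unforcedBefore P F x (aOf P F w) < ycount P F (blockOf P F x) then
        w (yOff P F (blockOf P F x) + unforcedBefore P F x (aOf P F w)) else false := rfl

/-- The block of `x ∈ B` splits at `x`: the variables before it, `x`, the variables after it.
[folklore] -/
theorem block_blockOf_eq (x : ℕ) (hx : x ∈ bList P F) :
    block P F (blockOf P F x) =
      (block P F (blockOf P F x)).take (posIn P F x) ++
        x :: (block P F (blockOf P F x)).drop (posIn P F x + 1) := by
  obtain ⟨h, e⟩ := getElem_block_blockOf P F hx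
  conv_lhs => rw [← List.take_append_drop (posIn P F x) (block P F (blockOf P F x))]
  rw [List.drop_eq_getElem_cons h, e]

/-! ### Nonempty blocks; `f`-vectors padded with zeros -/

/-- The number of nonempty blocks, `⌈|B| / m⌉`. [folklore] -/
def numNB : ℕ := ((bList P F).length + bsz P - 1) / bsz P

/-- Blocks from `numNB` on are empty. [folklore] -/
theorem block_eq_nil_of_numNB_le {i : ℕ} (hi : numNB P F ≤ i) : block P F i = [] := by
  apply block_eq_nil
  have hm := bsz_pos P
  unfold numNB at hi
  rw [Nat.div_le_iff_le_mul_add_pred hm] at hi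
  have := Nat.le_mul_of_pos_left (bList P F).length hm
  rw [Nat.mul_comm] at hi
  omega

/-- Blocks before `numNB` are nonempty. [folklore] -/
theorem length_block_pos {i : ℕ} (hi : i < numNB P F) : 0 < (block P F i).length := by
  have hm := bsz_pos P
  unfold numNB at hi
  have h1 := (Nat.le_div_iff_mul_le hm).1 (Nat.succ_le_of_lt hi)
  rw [Nat.succ_mul] at h1
  simp only [block, List.length_take, List.length_drop]
  omega

/-- `numNB ≤ numBlocks`. [folklore] -/
theorem numNB_le_numBlocks : numNB P F ≤ numBlocks P F := by
  have hm := bsz_pos P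
  unfold numNB numBlocks
  rw [Nat.div_le_iff_le_mul_add_pred hm]
  have := Nat.le_mul_of_pos_left (bList P F).length hm
  omega

/-- `numNB ≤ |B| / m + 1`. [folklore] -/
theorem numNB_le_div_add_one : numNB P F ≤ (bList P F).length / bsz P + 1 := by
  have hm := bsz_pos P
  unfold numNB
  rw [Nat.div_le_iff_le_mul_add_pred hm]
  have := Nat.lt_mul_div_succ (bList P F).length hm
  rw [Nat.mul_add, Nat.mul_one] at this ⊢
  omega

/-- The block sizes from `numNB` on vanish: `sizes = sizes.take numNB ++ 0…0`. [folklore] -/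
theorem sizes_eq_take_append :
    sizes P F = (sizes P F).take (numNB P F) ++ List.replicate (numBlocks P F - numNB P F) 0 := by
  have hq := numNB_le_numBlocks P F
  refine List.ext_getElem (by simp [sizes]; omega) fun i h1 h2 => ?_
  simp only [sizes, List.getElem_map, List.getElem_range]
  by_cases hi : i < numNB P F
  · rw [List.getElem_append_left (by simp; omega)]
    simp
  · rw [List.getElem_append_right (by simp; omega)]
    simp only [List.getElem_replicate]
    rw [block_eq_nil_of_numNB_le P F (not_lt.1 hi)]; rfl

/-- `f`-vectors over zero sizes. [folklore] -/
theorem fvecs_replicate_zero : ∀ j : ℕ, fvecs (List.replicate j 0) = [List.replicate j 0]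
  | 0 => rfl
  | j + 1 => by
    rw [List.replicate_succ, fvecs, fvecs_replicate_zero j]
    simp

/-- `f`-vectors over sizes padded with zeros are the padded `f`-vectors. [folklore] -/
theorem fvecs_append_replicate_zero : ∀ (ss : List ℕ) (j : ℕ),
    fvecs (ss ++ List.replicate j 0) = (fvecs ss).map (· ++ List.replicate j 0)
  | [], j => by rw [List.nil_append, fvecs_replicate_zero]; simp [fvecs]
  | s :: ss, j => by
    rw [List.cons_append, fvecs, fvecs_append_replicate_zero ss j, fvecs, List.map_flatMap]
    simp [List.map_map, Function.comp_def]

/-- `getD` with default `0` ignores a padding by zeros. [folklore] -/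
theorem getD_append_replicate_zero : ∀ (l : List ℕ) (j i : ℕ),
    (l ++ List.replicate j 0).getD i 0 = l.getD i 0
  | [], j, i => by
    simp only [List.nil_append, List.getD_eq_getElem?_getD, List.getElem?_replicate,
      List.getElem?_nil, Option.getD_none]
    split <;> rfl
  | a :: l, j, 0 => by simp
  | a :: l, j, i + 1 => by
    simp only [List.cons_append, List.getD_cons_succ]
    exact getD_append_replicate_zero l j i

section ZeroPad

variable (j : ℕ)

/-- The parameters with the `f`-vector padded by `j` zeros. [folklore] -/
def padZ : Params := { P with fv := P.fv ++ List.replicate j 0 }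

/-- Padding does not change `fAt`. [folklore] -/
theorem fAt_padZ (i : ℕ) : fAt (padZ P j) F i = fAt P F i := by
  unfold fAt
  have : (padZ P j).fv.getD i 0 = P.fv.getD i 0 := getD_append_replicate_zero P.fv j i
  rw [this]; rfl


/-- Padding does not change `ycount`. [folklore] -/
theorem ycount_padZ (i : ℕ) : ycount (padZ P j) F i = ycount P F i := by
  unfold ycount; rw [fAt_padZ]; rfl

/-- Padding does not change `yOff`. [folklore] -/
theorem yOff_padZ : ∀ i : ℕ, yOff (padZ P j) F i = yOff P F i
  | 0 => rfl
  | i + 1 => by rw [yOff, yOff, yOff_padZ i, ycount_padZ]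

/-- Padding does not change `fSum`. [folklore] -/
theorem fSum_padZ : fSum (padZ P j) F = fSum P F := by
  unfold fSum
  have h : fAt (padZ P j) F = fAt P F := funext (fAt_padZ P F j)
  rw [h]; rfl

/-- Padding does not change `newIdxY`. [folklore] -/
theorem newIdxY_padZ (i r : ℕ) : newIdxY (padZ P j) F i r = newIdxY P F i r := by
  unfold newIdxY; rw [yOff_padZ]

/-- Padding does not change `yval`. [folklore] -/
theorem yval_padZ (x : ℕ) (w : ℕ → Bool) : yval (padZ P j) F x w = yval P F x w := by
  unfold yval; rw [ycount_padZ, newIdxY_padZ]; rfl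

/-- Padding does not change `psi`. [folklore] -/
theorem psi_padZ (x : ℕ) (w : ℕ → Bool) : psi (padZ P j) F x w = psi P F x w := by
  unfold psi; rw [yval_padZ]; rfl

/-- Padding does not change `valVar`. [folklore] -/
theorem valVar_padZ (x : ℕ) (w : ℕ → Bool) : valVar (padZ P j) F x w = valVar P F x w := by
  unfold valVar; rw [psi_padZ]; rfl

/-- Padding does not change `gClause`. [folklore] -/
theorem gClause_padZ (c : List (ℕ × Bool)) : gClause (padZ P j) F c = gClause P F c := by
  funext w; unfold gClause
  exact any_congr_mem c fun l _ => by rw [valVar_padZ]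

/-- Padding does not change `theta`. [folklore] -/
theorem theta_padZ (i : ℕ) : theta (padZ P j) F i = theta P F i := by
  funext w; unfold theta; rw [fAt_padZ]; rfl

/-- Padding does not change `depBlock`. [folklore] -/
theorem depBlock_padZ (i : ℕ) : depBlock (padZ P j) F i = depBlock P F i := by
  unfold depBlock
  rw [ycount_padZ]
  have h : newIdxY (padZ P j) F i = newIdxY P F i := funext (newIdxY_padZ P F j i)
  rw [h]; rfl

/-- Padding does not change `depVar`. [folklore] -/
theorem depVar_padZ (x : ℕ) : depVar (padZ P j) F x = depVar P F x := by
  unfold depVar; rw [depBlock_padZ]; rfl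

/-- Padding does not change `depClause`. [folklore] -/
theorem depClause_padZ (c : List (ℕ × Bool)) : depClause (padZ P j) F c = depClause P F c := by
  unfold depClause
  exact List.flatMap_congr fun l _ => depVar_padZ P F j l.1

/-- Padding does not change the output clauses. [folklore] -/
theorem outClauses_padZ : outClauses (padZ P j) F = outClauses P F := by
  unfold outClauses
  have h1 : (F.flatMap fun c => cnf (gClause (padZ P j) F c) (depClause (padZ P j) F c)) =
      F.flatMap fun c => cnf (gClause P F c) (depClause P F c) :=
    List.flatMap_congr fun c _ => by rw [gClause_padZ, depClause_padZ]
  have h2 : ((List.range (numBlocks (padZ P j) F)).flatMap fun i =>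
      cnf (theta (padZ P j) F i) (depTheta (padZ P j) F i)) =
      (List.range (numBlocks P F)).flatMap fun i => cnf (theta P F i) (depTheta P F i) :=
    List.flatMap_congr fun i _ => by rw [theta_padZ]; rfl
  rw [h1, h2]

/-- **Padding the `f`-vector with zeros does not change the reduced formula.** [folklore] -/
theorem reduce_padZ {k : ℕ} (cap len : ℕ) (mask : ℕ → Bool) (fv : List ℕ) (φ : KCNF k) :
    reduce ⟨cap, len, mask, fv ++ List.replicate j 0⟩ φ = reduce ⟨cap, len, mask, fv⟩ φ := by
  have h1 := fSum_padZ ⟨cap, len, mask, fv⟩ φ.clauses j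
  have h2 := outClauses_padZ ⟨cap, len, mask, fv⟩ φ.clauses j
  simp only [padZ] at h1 h2
  unfold reduce
  simp only [KCNF.mk.injEq]
  exact ⟨by rw [h1], h2⟩

/-- **`reduceList` over the nonempty blocks only**: the `f`-vectors may be enumerated over the
sizes of the `numNB` nonempty blocks (the remaining components are forced to `0` and change
neither the threshold test nor the reduced formula). [folklore] -/
theorem reduceList_eq_numNB (k cap len t : ℕ) (φ : KCNF k) :
    reduceList k cap len t φ = (tuples (numCols k cap)).flatMap fun bs =>
      ((fvecs ((sizes ⟨cap, len, maskOf bs, []⟩ φ.clauses).take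
          (numNB ⟨cap, len, maskOf bs, []⟩ φ.clauses))).filter fun fv => decide (t ≤ fv.sum)).map
        fun fv => (reduce ⟨cap, len, maskOf bs, fv⟩ φ : KCNF (kOut k cap len)) := by
  unfold reduceList
  refine List.flatMap_congr fun bs _ => ?_
  set P₀ : Params := ⟨cap, len, maskOf bs, []⟩ with hP₀
  set r := numBlocks P₀ φ.clauses - numNB P₀ φ.clauses with hr
  conv_lhs => rw [sizes_eq_take_append P₀ φ.clauses, fvecs_append_replicate_zero]
  rw [List.filter_map, List.map_map]
  have hf : ((fun fv : List ℕ => decide (t ≤ fv.sum)) ∘ fun x => x ++ List.replicate r 0) =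
      fun fv => decide (t ≤ fv.sum) := by
    funext fv; simp
  rw [hf]
  refine List.map_congr_left fun fv _ => ?_
  simp only [Function.comp_apply]
  exact reduce_padZ r cap len (maskOf bs) fv φ

end ZeroPad

end Literature.Computability.FineGrained.IPRename

/-! ### Tables of the renaming machine and their words over `Γ'` -/

namespace Literature.Computability.FineGrained.IPRenameM

open _root_.Computability Complexity Sparsifier IPRename

variable (P : Params) (F : List (List (ℕ × Bool)))

/-- The token of a natural number: its binary digits (least significant first) closed by a
comma. [folklore] -/
def wIdx (ν : ℕ) : List Γ' := (encodeNat ν).map Γ'.bit ++ [Γ'.comma]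

/-- The word of a forcing-table entry: the two pattern flags as a two-symbol token, then the
renamed `A`-literals, closed by `ket`. [folklore] -/
def wEntry (e : Entry) : List Γ' :=
  Γ'.bit e.pt :: Γ'.bit e.pf :: Γ'.comma :: (cbody e.lits ++ [Γ'.ket])

/-- The word of the forcing table of one variable: its entries, closed by `bra`. [folklore] -/
def wVar (es : List Entry) : List Γ' := es.flatMap wEntry ++ [Γ'.bra]

/-- The word of a block: the tables of its variables in order, closed by `blank`. [folklore] -/
def wBlock (zs : List (List Entry)) : List Γ' := zs.flatMap wVar ++ [Γ'.blank]

/-- **The block table**: for each nonempty block, the forcing tables of its variables.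
[folklore] -/
def btab : List (List (List Entry)) :=
  (List.range (numNB P F)).map fun i => (block P F i).map (entries P F)

/-- The word of a block table. [folklore] -/
def wBT (t : List (List (List Entry))) : List Γ' := t.flatMap wBlock

/-- Annotated literals: an `A`-literal carries its new index, a `B`-literal the index of its
block and its position in the block. [folklore] -/
inductive ALit where
  /-- an `A`-literal `(x, p)` with `ν = newIdxA x` -/
  | a (ν : ℕ) (p : Bool)
  /-- a `B`-literal `(x, p)` with `i = blockOf x`, `j = posIn x` -/
  | b (i j : ℕ) (p : Bool)

/-- The annotation of a literal. [folklore] -/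
def annLit (l : ℕ × Bool) : ALit :=
  if inB P F l.1 then ALit.b (blockOf P F l.1) (posIn P F l.1) l.2 else ALit.a (newIdxA P F l.1) l.2

/-- The word of an annotated literal: polarity bit, tag bit (`false` = `A`, `true` = `B`), then
the index token, respectively `i` kets and `j` bras closed by a comma. [folklore] -/
def wALit : ALit → List Γ'
  | ALit.a ν p => Γ'.bit p :: Γ'.bit false :: wIdx ν
  | ALit.b i j p => Γ'.bit p :: Γ'.bit true ::
      (List.replicate i Γ'.ket ++ List.replicate j Γ'.bra ++ [Γ'.comma])

/-- The word of an annotated clause: its annotated literals, closed by `blank`. [folklore] -/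
def wAClause (c : List (ℕ × Bool)) : List Γ' := (c.map (annLit P F)).flatMap wALit ++ [Γ'.blank]

/-- **The annotated clause list.** [folklore] -/
def wAC : List Γ' := F.flatMap (wAClause P F)

/-- The word of one block of the `Y`-table: `f_i` blanks, a comma, the tokens of the new indices
of the renaming variables `Y_i`, closed by `ket`. [folklore] -/
def wYBlock (f : ℕ) (ys : List ℕ) : List Γ' :=
  List.replicate f Γ'.blank ++ Γ'.comma :: (ys.flatMap wIdx ++ [Γ'.ket])

/-- **The `Y`-table** (for the current `f`-vector): for each nonempty block, `f_i` and the new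
indices `newIdxY i 0, …, newIdxY i (|Y_i| - 1)`. [folklore] -/
def ytab : List (ℕ × List ℕ) :=
  (List.range (numNB P F)).map fun i => (fAt P F i, (List.range (ycount P F i)).map (newIdxY P F i))

/-- The word of a `Y`-table. [folklore] -/
def wYT (t : List (ℕ × List ℕ)) : List Γ' := t.flatMap fun b => wYBlock b.1 b.2

/-- The comma is the only non-bit of an index token, at its end. [folklore] -/
theorem wIdx_eq (ν : ℕ) : wIdx ν = (encodeNat ν).map Γ'.bit ++ [Γ'.comma] := rfl

/-- A literal token is a polarity bit followed by an index token. [folklore] -/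
theorem encodeLiteral_eq_wIdx (l : ℕ × Bool) : KCNF.encodeLiteral l = Γ'.bit l.2 :: wIdx l.1 := rfl

end Literature.Computability.FineGrained.IPRenameM
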